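/-
Copyright (c) 2026 the pub-hodgecm-mathlib formalisation cell (harness21).  R90-TF SLAB, section S10 (Rogawski 1990, Ch. 13.8), prover R90-C138-p01 (g0):
DEAL #88 (dealer R90-C138-plan (g4), 2026-09-05T03:35:40Z) — the keystone's ROW-6 inputs OF RECORD: the `hLO` binder from the ★ `hex` family, and the package `t₀`
IN THE KEYSTONE'S GERM SUBTYPE at the pins of record `bdRec ∕ σRec`; h413 = `stmt-HodgeConjecture-24833`, route `HCCMUnconditional`.
-/
import Summits.HodgeConjecture.HodgeConjecture.Theorems.R90S10HexOfLevelTraces       -- ★ p865075 (K2Liu-p13 #69 (b)): `exists_eigenvaluePackage_hexFamily_of_levelTraces_of_subset` (from `hPS♭`); brings ★ p07 rigidity + ★ C2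
import Summits.HodgeConjecture.HodgeConjecture.Theorems.R90S10GermOfRecordMem         -- ★ p863389: `norm_classSphericalFunctional_le_heckeBoundOfRecord`, `classSphericalFunctional_heckeStarOfRecord`; brings ★ `bdRec`, `σRec`, `isHeckeTriple_cmLocalIntegralLevel`
import Summits.HodgeConjecture.HodgeConjecture.Theorems.R90S10FrozenFamilyMaps       -- ★ p863410 (this seat): `HeckeQs` (the keystone's `𝓗`)
import HarnessLib

/-!
# R90-TF ∕ S10 — ROW 6 OF RECORD FOR THE KEYSTONE: `hLO_of_hexFamily`, `exists_recordGerm_hexFamily_of_levelTraces`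

Cell hodgecm-mathlib, slab R90-TF, section S10 = [Rogawski1990] §13.8 (p. 219 L2–L3), crux item h413 = `stmt-HodgeConjecture-24833`; kernel lane
`--kind proof --supports stmt-HodgeConjecture-24833 --as helper`; THEOREMS ONLY (no `def`, no instance, no notation, no `sorry`); never imports `Cruxes/…/Lines`.

The keystone ★ p865101 `Theorems/R90S10StabilisedAtEvp2OfInputs.lean :: stabilisedAtEvp_of_inputs` binds, for the germ package
`t₀ : {t : Ch13Sec6.EigenvaluePackage S (HeckeQs L) // (∀ i x, ‖t i x‖ ≤ bd i x) ∧ ∀ i x, t i (σ i x) = conj (t i x)}` (instantiated at the pins of record `bd := bdRec`,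
`σ := σRec`, ★ `R90S10GermPinsOfRecordDefs`), the row-6 letters `hex` (∃-form: some admissible `U(Φ₃)(𝒪_w)`-spherical class of character `(t₀)_w` lies over `ρ_w`) and — in
★ p07's (P-rig) variants — `hLO` (every admissible unitarizable spherical class of character `(t₀)_w` lies over `ρ_w`).  THIS FILE supplies them OF RECORD:
* §1 `hLO_of_hexFamily` — `hex ⇒ hLO` by e.v.p. RIGIDITY (★ `liesOver_of_exists_of_unopClassSphericalCharacter_eq`, p07): a class with the character of the witness IS the
  witness [§13.6 p. 209; CartierCorvallis1979 §IV.1 Cor. 4.1].  Unconditional given `hex`.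
* §2 `exists_recordGerm_hexFamily_of_levelTraces` — from ⟪U⟫, `μ|_{𝕀_{L⁺}} = ω`, the shrunk PS letter `hPS♭` (K2Liu-p13's road (b): ★ p865075) AND ONE NAMED LOCAL LETTER
  `hUnit` («every admissible `U(Φ₃)(𝒪_w)`-spherical class lying over `ρ_w` is UNITARIZABLE» — the unramified endoscopic transfer of the unitary `ρ_w` is unitary; class
  (E1-c)-local, NOT in house), the package `t₀` IN THE SUBTYPE at `bdRec ∕ σRec` with the `hex` family at `t₀.1`: the bare package of ★ p865075 is `bdRec`-bounded and `σRec`-real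
  componentwise because its components ARE spherical characters of unitarizable classes (★ `norm_classSphericalFunctional_le_heckeBoundOfRecord`, ★
  `classSphericalFunctional_heckeStarOfRecord` — both REQUIRE unitarizability: that requirement IS the gap `hUnit`, reported as dealt) [§10.3 p. 159; §13.7 p. 213].
So the keystone's consumer does `obtain ⟨t₀, hex⟩ := exists_recordGerm_hexFamily_of_levelTraces hunr hμω 𝔣 S hv hPS♭ hUnit` and feeds `hex`, and `hLO_of_hexFamily 𝔣 S t₀.1 hex`
where the `hLO` form is asked.

HONEST LABEL: row 6 of record is paid modulo `hPS♭` (shrunk PS letter, ★ road (b)), `hUnit` (unitarizability of the partners, (E1-c)-local, new NAMED residual) and ⟪P⟫ ⟪U⟫; HC_CM is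
proved only modulo the 7 printed citations (2 remaining named inputs: hLiu418 = `stmt-HodgeConjecture-24832`, h413 = `stmt-HodgeConjecture-24833`) until rung 0 closes; REL ≠ ★ ≠ BUILT.

## References
* [Rogawski1990] J. Rogawski, *Automorphic Representations of Unitary Groups in Three Variables*, Ann. of Math. Stud. 123 (1990), §13.8 p. 219 L2–L3; §13.6 p. 209; §13.7 p. 213;
  §10.3 p. 159; §12.1 p. 171.
* [CartierCorvallis1979] P. Cartier, *Representations of 𝔭-adic groups: a survey*, Proc. Sympos. Pure Math. 33.1 (1979), §IV.1 Thm. 4.1, Cor. 4.1–4.2.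
* [DeitmarEchterhoff2014] A. Deitmar, S. Echterhoff, *Principles of Harmonic Analysis*, 2nd ed. (2014), Prop. 6.2.1.
-/

set_option autoImplicit false
set_option linter.dupNamespace false

noncomputable section

open scoped RestrictedProduct Matrix MatrixGroups
open Filter MeasureTheory NumberField IsDedekindDomain CompactlySupported
open Literature.NumberTheory.Rogawski1990 Literature.NumberTheory.Automorphic Literature.NumberTheory.Automorphic.UnitaryGroup
open Literature.NumberTheory.Automorphic.UnitaryGroup.CotangentForms Literature.NumberTheory.GaloisRepresentations
open Literature.NumberTheory.Automorphic.Arthur2013.Leaves.TECR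
open Summit.HodgeConjecture.HodgeConjecture.Cruxes.H413
open Summit.HodgeConjecture.HodgeConjecture.Cruxes.H413.K2E1TraceFormulaBeta
open Summit.HodgeConjecture.HodgeConjecture.Cruxes.H413.K2E1SpectralTermsDiscreteHalf
open Summit.HodgeConjecture.HodgeConjecture.Cruxes.H413.K2E1EvpOfAutomorphicClass
open Summit.HodgeConjecture.HodgeConjecture.Cruxes.H413.K2E1EigenvaluePackageOfSpherical

namespace Summit.HodgeConjecture.HodgeConjecture.R90.S10

section Frozen

variable {L : Type} [Field L] [NumberField L] [IsCMField L] [DecidableEq (Pl L)] {μ : HeckeCharacter L} {v : Pl L}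
  [MeasurableSpace (HLoc L v)] [BorelSpace (HLoc L v)] [MeasurableSpace (Gqs L v)] [BorelSpace (Gqs L v)]
  {νHv : Measure (HLoc L v)} {νQv : Measure (Gqs L v)} [νHv.IsHaarMeasure] [νHv.IsMulRightInvariant] [νQv.IsHaarMeasure] [νQv.IsMulRightInvariant]
  [∀ a : HLoc L v, MeasurableSpace (HLoc L v ⧸ Subgroup.centralizer ({a} : Set (HLoc L v)))]
  [∀ a : HLoc L v, BorelSpace (HLoc L v ⧸ Subgroup.centralizer ({a} : Set (HLoc L v)))]
  [∀ γ : Gqs L v, MeasurableSpace (Gqs L v ⧸ Subgroup.centralizer ({γ} : Set (Gqs L v)))]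
  [∀ γ : Gqs L v, BorelSpace (Gqs L v ⧸ Subgroup.centralizer ({γ} : Set (Gqs L v)))]
  {mHv : OrbitalMeasureFamily (HLoc L v)} {mQv : OrbitalMeasureFamily (Gqs L v)} {πSt : IrrClass (HLoc L v)}
  [MeasurableSpace (G3 L).Adelic] [BorelSpace (G3 L).Adelic] [MeasurableSpace (H2 L).Adelic] [BorelSpace (H2 L).Adelic]
  [MeasurableSpace (GArch L)] [BorelSpace (GArch L)] [MeasurableSpace (HArch L)] [BorelSpace (HArch L)]
  [MeasurableSpace (H1Loc L v)] [MeasurableSpace (H1Arch L)] [MeasurableSpace (H1 L).Adelic] [BorelSpace (H1 L).Adelic]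

/-! ## §1 `hex ⇒ hLO` by rigidity -/

/-- **THE `hLO` BINDER OF RECORD FROM THE `hex` FAMILY** (the `hLO` binder of ★ `rigidityAtGermLetter_of_liesOver` VERBATIM): if at each `w ≠ v`, `w ∉ S`, SOME admissible
`U(Φ₃)(𝒪_w)`-spherical class of character `(t₀)_w` lies over `ρ_w`, then EVERY admissible (unitarizable) spherical class of character `(t₀)_w` lies over `ρ_w` — it IS that
class (e.v.p. rigidity ★ `liesOver_of_exists_of_unopClassSphericalCharacter_eq`). [cite: Rogawski1990, §13.8 p. 219 L2–L3; §13.6 p. 209] [cite: CartierCorvallis1979, §IV.1 Cor. 4.1] -/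
theorem hLO_of_hexFamily (𝔣 : S10FrozenDatum L μ v νHv νQv mHv mQv πSt) (S : Set (Pl L))
    (t₀ : Ch13Sec6.EigenvaluePackage S fun w => heckeAlgebra ℂ (Gqs L w) (cmLocalIntegralLevel L 3 (qsForm L) w))
    (hex : ∀ (w : {w : Pl L // w ≠ v}) (hwS : w.1 ∉ S), ∃ π₀ : IrrClass (Gqs L w.1), π₀.IsAdmissible ∧ ∃ h₀ : π₀.IsSpherical (cmLocalIntegralLevel L 3 (qsForm L) w.1),
      unopClassSphericalCharacter (cmLocalIntegralLevel L 3 (qsForm L) w.1) π₀ h₀ = t₀ ⟨w.1, hwS⟩ ∧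
        LiesOver L μ w.1 (𝔣.𝔳.K w.1) (𝔣.𝔥.KH w.1) (𝔣.𝔳.νQ w) (𝔣.𝔳.νHw w) (𝔣.𝔳.mH w) (𝔣.𝔳.mQ w) π₀ (𝔣.𝔥.ρ w.1)) :
    ∀ (w : {w : Pl L // w ≠ v}) (hwS : w.1 ∉ S) (π : IrrClass (Gqs L w.1)), π.IsAdmissible → π.IsUnitarizable →
      ∀ hπ : π.IsSpherical (cmLocalIntegralLevel L 3 (qsForm L) w.1),
        unopClassSphericalCharacter (cmLocalIntegralLevel L 3 (qsForm L) w.1) π hπ = t₀ ⟨w.1, hwS⟩ →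
          LiesOver L μ w.1 (𝔣.𝔳.K w.1) (𝔣.𝔥.KH w.1) (𝔣.𝔳.νQ w) (𝔣.𝔳.νHw w) (𝔣.𝔳.mH w) (𝔣.𝔳.mQ w) π (𝔣.𝔥.ρ w.1) :=
  fun w hwS π hadm _ hπ heig => liesOver_of_exists_of_unopClassSphericalCharacter_eq 𝔣 w (t₀ ⟨w.1, hwS⟩) (hex w hwS) π hadm hπ heig

/-! ## §2 The package OF RECORD in the germ subtype at `bdRec ∕ σRec`, modulo the unitarizability letter `hUnit` -/

set_option maxHeartbeats 800000 in  -- the germ subtype at `bdRec ∕ σRec` over `HeckeQs` vs `(cmDatum L 3 (qsForm L)).Local` (defeq unfoldings)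
/-- **ROW 6 OF RECORD — the package `t₀` IN THE KEYSTONE'S GERM SUBTYPE with its `hex` family**: from ⟪U⟫, `μ|_{𝕀_{L⁺}} = ω`, the shrunk PS letter `hPS♭` (★ p865075's
binder, bytes verbatim) and the unitarizability letter `hUnit`, there is `t₀` bounded by `bdRec` and real for `σRec` (the keystone's subtype at the pins of record) such that at
every `w ≠ v`, `w ∉ S`, some admissible spherical class of character `(t₀.1)_w` lies over `ρ_w` (the keystone's `hex` binder VERBATIM).  The bound and the star law are ★
`norm_classSphericalFunctional_le_heckeBoundOfRecord` ∕ ★ `classSphericalFunctional_heckeStarOfRecord` at the UNITARIZABLE witness classes (`hUnit`).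
[cite: Rogawski1990, §13.8 p. 219 L2–L3; §10.3 p. 159; §13.7 p. 213; §13.6 p. 209] [cite: DeitmarEchterhoff2014, Prop. 6.2.1] [cite: CartierCorvallis1979, §IV.1 Cor. 4.1–4.2] -/
theorem exists_recordGerm_hexFamily_of_levelTraces
    (hunr : ∀ w : Pl L, w ≠ v → ∀ W : PlacesOver L w, Algebra.IsUnramifiedAt (𝓞 ↥(maximalRealSubfield L)) W.1.asIdeal ∧ μ.IsUnramifiedAt W.1)
    (hμω : ∀ x : Literature.NumberTheory.GaloisRepresentations.ideleGroup ↥(maximalRealSubfield L),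
      μ (AdeleRing.ideleBaseChange (↥(maximalRealSubfield L)) L x) = quadraticHeckeCharCM L x)
    (𝔣 : S10FrozenDatum L μ v νHv νQv mHv mQv πSt) (S : Set (Pl L)) (hv : v ∈ S)
    (hPS : ∀ w : {w : Pl L // w ≠ v}, ∃ (χ₂ : ↥(torusU (conjLocal L (IsCMField.complexConj L) w.1) (cmLocalForm L 2 w.1)) →* ℂˣ) (χ₁ : H1Loc L w.1 →* ℂˣ),
      IsOpen ((χ₁.ker : Subgroup (H1Loc L w.1)) : Set (H1Loc L w.1)) ∧
        Module.finrank ℂ ↥((cmPrincipalSeriesH L w.1 χ₂ χ₁).fixedPoints (𝔣.𝔥.KH w.1)) = 1 ∧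
          (letI := 𝔣.𝔥.acV w.1
           letI := 𝔣.𝔥.mdV w.1
           letI := 𝔣.𝔳.msH w
           ∀ fH : HLoc L w.1 → ℂ, IsLocSmooth fH → IsLevel (𝔣.𝔥.KH w.1) fH →
             (𝔣.𝔥.ρ w.1).smoothTrace (𝔣.𝔳.νHw w) fH = (cmPrincipalSeriesH L w.1 χ₂ χ₁).smoothTrace (𝔣.𝔳.νHw w) fH))
    (hUnit : ∀ (w : {w : Pl L // w ≠ v}) (π₀ : IrrClass (Gqs L w.1)), π₀.IsAdmissible →
      ∀ h₀ : π₀.IsSpherical (cmLocalIntegralLevel L 3 (qsForm L) w.1),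
        LiesOver L μ w.1 (𝔣.𝔳.K w.1) (𝔣.𝔥.KH w.1) (𝔣.𝔳.νQ w) (𝔣.𝔳.νHw w) (𝔣.𝔳.mH w) (𝔣.𝔳.mQ w) π₀ (𝔣.𝔥.ρ w.1) → π₀.IsUnitarizable) :
    ∃ t₀ : {t : Ch13Sec6.EigenvaluePackage S (HeckeQs L) //
        (∀ i x, ‖t i x‖ ≤ bdRec L (qsForm L) S i x) ∧ ∀ i x, t i (σRec L (qsForm L) S i x) = (starRingEnd ℂ) (t i x)},
      ∀ (w : {w : Pl L // w ≠ v}) (hwS : w.1 ∉ S), ∃ π₀ : IrrClass (Gqs L w.1), π₀.IsAdmissible ∧ ∃ h₀ : π₀.IsSpherical (cmLocalIntegralLevel L 3 (qsForm L) w.1),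
        unopClassSphericalCharacter (cmLocalIntegralLevel L 3 (qsForm L) w.1) π₀ h₀ = t₀.1 ⟨w.1, hwS⟩ ∧
          LiesOver L μ w.1 (𝔣.𝔳.K w.1) (𝔣.𝔥.KH w.1) (𝔣.𝔳.νQ w) (𝔣.𝔳.νHw w) (𝔣.𝔳.mH w) (𝔣.𝔳.mQ w) π₀ (𝔣.𝔥.ρ w.1) := by
  obtain ⟨t, ht⟩ := exists_eigenvaluePackage_hexFamily_of_levelTraces_of_subset hunr hμω 𝔣 S hv hPS
  -- every component of the package is the spherical character of a UNITARIZABLE spherical class (the `hex` witness, `hUnit`)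
  have aux : ∀ i : {i : Pl L // i ∉ S}, ∃ (π₀ : IrrClass (Gqs L i.1)) (h₀ : π₀.IsSpherical (cmLocalIntegralLevel L 3 (qsForm L) i.1)),
      π₀.IsUnitarizable ∧ unopClassSphericalCharacter (cmLocalIntegralLevel L 3 (qsForm L) i.1) π₀ h₀ = t i := fun i => by
    have hi : i.1 ≠ v := fun h => i.2 (h ▸ hv)
    obtain ⟨π₀, hadm, h₀, heq, hLO⟩ := ht ⟨i.1, hi⟩ i.2
    exact ⟨π₀, h₀, hUnit ⟨i.1, hi⟩ π₀ hadm h₀ hLO, heq⟩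
  refine ⟨⟨t, fun i x => ?_, fun i x => ?_⟩, ht⟩
  · obtain ⟨π₀, h₀, hU, heq⟩ := aux i
    letI := isHeckeTriple_cmLocalIntegralLevel L (qsForm L) i.1
    rw [← heq, unopClassSphericalCharacter_apply, classSphericalCharacter_apply, bdRec_apply]
    exact norm_classSphericalFunctional_le_heckeBoundOfRecord (cmLocalIntegralLevel L 3 (qsForm L) i.1) π₀ h₀ hU x
  · obtain ⟨π₀, h₀, hU, heq⟩ := aux i
    letI := isHeckeTriple_cmLocalIntegralLevel L (qsForm L) i.1
    rw [← heq, unopClassSphericalCharacter_apply, unopClassSphericalCharacter_apply, classSphericalCharacter_apply, classSphericalCharacter_apply,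
      σRec_apply]
    exact classSphericalFunctional_heckeStarOfRecord (cmLocalIntegralLevel L 3 (qsForm L) i.1) π₀ h₀ hU x

end Frozen

end Summit.HodgeConjecture.HodgeConjecture.R90.S10

end
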